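import Mathlib
import Literature.NumberTheory.LFunctions.Zhang2022.Section15AU021
import Literature.NumberTheory.LFunctions.Zhang2022.Section15Eq1511Edges
import HarnessLib

/-!
# Zhang (2022) §15 p. 83: the displays u024 and (15.11) at the χ-twisted coefficients HOLD

Topic `Literature/NumberTheory/LFunctions/Zhang2022` (Landau–Siegel audit tree; verdict-neutral).
Y. Zhang, *Discrete mean estimates and the Landau–Siegel zero*, arXiv:2211.02515v1 (2022)
[Zhang2022LandauSiegel] — **an unrefereed manuscript under adjudication** (ZHANG-L discharge lane,
WP15 leaf `Typed.Section15B.Eq15_17 c' bChi`). Nodes `Z22:§15.u024` [Z22 p. 83, tex L4147] and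
`Z22:(15.11)` [Z22 p. 83, tex L4154] at the χ-absorbed coefficient family `bChi` (reading of record,
GAP row G-L4t1-1): the tree's edges `step15_u024_chi_of_u021` and `eq15_11_chi_of_u021`
(`Section15Eq1511Edges`, zl-libA-p4) fed with the node `Z22:§15.u021` now a theorem
(`step15_u021_holds`, `Section15AU021`).

* `step15_u024_chi_holds : Step15_u024 c' bChi`, `eq15_11_chi_holds : Eq15_11 c' bChi` (every `c′`).

Pure compositions; no new definitions, no named facts, no `sorry`. CONDITIONAL on (A) as the
manuscript; nothing here bears on Theorems 1–2 of the source or on Landau–Siegel zeros.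

## References

* Y. Zhang, arXiv:2211.02515v1 (2022), §15 p. 83, (15.11). [cite: Zhang2022LandauSiegel, §15 (15.11) p.83]
-/

noncomputable section

namespace Literature.NumberTheory.LFunctions.Zhang2022.Typed.Section15A

/-- **`Z22:§15.u024` HOLDS at `bChi`**: `Σ_d g̃₃(dk)/d Σ_{(l,k)=1}(κ₁∗b)(dl)χ(l)Δ(l/(Dpk)) =
𝓡₁*Dpk ΣΣ g̃₃(d₁d₂k)/(d₁d₂)·κ̃₁λ₁ Σ b(d₂l₂)χ(l₂)/l₂ + O(α³⁰Dpk)` — the edge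
`step15_u024_chi_of_u021` at the theorem `step15_u021_holds`. [cite: Zhang2022LandauSiegel, §15 p.83 (u024)] -/
theorem step15_u024_chi_holds (c' : ℝ) : Step15_u024 c' bChi :=
  step15_u024_chi_of_u021 c' (step15_u021_holds c')

/-- **`Z22:(15.11)` HOLDS at `bChi`**: `Φ₁(p) = (𝓡₁*Dp/φ(D)) Σ_d Σ_l b(dl)χ(l)/(dl)·𝔇₁(d,l) + o(P)` —
the edge `eq15_11_chi_of_u021` at `step15_u021_holds`. [cite: Zhang2022LandauSiegel, §15 (15.11) p.83] -/
theorem eq15_11_chi_holds (c' : ℝ) : Eq15_11 c' bChi :=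
  eq15_11_chi_of_u021 c' (step15_u021_holds c')

end Literature.NumberTheory.LFunctions.Zhang2022.Typed.Section15A

end
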